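import Summits.BirchSwinnertonDyer.Rank1Residual.X2.GreenbergVatsalUnramifiedAway
import Literature.NumberTheory.GaloisRepresentations.LocalHOneInertiaRestrictionProfinite
import Literature.NumberTheory.GaloisRepresentations.LocalGaloisGroupFrobeniusProofs
import Literature.NumberTheory.GaloisRepresentations.DecompositionGroupOfCompletion
import Literature.NumberTheory.GaloisRepresentations.GaloisCohomology
import Literature.NumberTheory.Automorphic.AdicCompletionResidueCard
import Literature.NumberTheory.EllipticCurves.KummerSelmerStructure
import HarnessLib

/-!
# CHARACTER SUPPLY for the Kummer-character sockets: the characters `χ_ℓ = π₀ ∘ (χ_cyc,ℓ mod ℓ)` of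
# `Γ_K`, unramified off `ℓ`, trivial on `Γ_{K_v}` when `π₀(N v mod ℓ) = 1`; existence of `π₀` for
# `p ∣ ℓ − 1`; and the ONE-KUMMER-PRIME certificate `λ ≥ #S` at the étale end
# (route `EisensteinPrimes`, crux 3 `MazurMCOnCellB` = stmt-BirchSwinnertonDyer-19033, line `mudescent`,
# stub 4″ `stub_lambdaCountWeak_offLocus`, ALGEBRAIC half; width seat bsd-line-x2-p1-w3, D-0154 row 5)

HONEST FRAMING (cell `bsd-eis`; nothing here proves BSD or a main conjecture; 0 cells move): THEOREMS
ONLY — no definition, no named fact, nothing asserted about any particular curve, closes nothing. The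
sockets p630234 / p631949 / p633408 take a CERTIFICATE `V`: a finite group of continuous characters
`Γ_ℚ →ₜ* ℤ/p` with prescribed local behaviour. This file supplies such characters from the cyclotomic
characters, so that a certificate reduces to RESIDUE CHECKS `q^{(ℓ−1)/p} ≡ 1 (mod ℓ)`:

* §1 (any number field `K`, any prime `ℓ`, any hom `π₀ : (ℤ/ℓ)ˣ → ℤ/p`)
  `exists_character_of_cyclotomicCharacter` — a continuous character `χ : Γ_K →ₜ* ℤ/p` and a reduction
  `red : ℤ_ℓ → ℤ/ℓ` (`red n = n`) with `χ σ = π₀(red χ_cyc,ℓ(σ))` (tree `GaloisRep.cyclotomicCharacter`;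
  continuity through `PadicInt.toZModPow 1`); `character_eq_one_of_mem_absInertia` — `χ` is UNRAMIFIED at
  every `v ∤ ℓ` (the cyclotomic character kills `I_v`, Serre I-1.2; tree
  `smul_eq_self_of_mem_inertia_of_pow_prime_pow_eq_one`); `character_eq_one_of_residueCard` — if
  `π₀(u) = 1` for the unit `u = N v (mod ℓ)`, then `χ` is TRIVIAL on the whole decomposition group `Γ_{K_v}`
  (`χ_cyc,ℓ(Frob_v) = N v`, tree `GaloisRep.cyclotomicCharacter_apply_of_isArithFrobAt` with the local/global
  Frobenius dictionary `isArithFrobAt_absGaloisRestrict_adicCompletionPrime_iff`, and DENSITY of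
  `I_v·⟨Frob⟩` in `Γ_{K_v}`, tree `dense_absInertia_mul_zpowers_of_isFrobPow`);
  `exists_unitsHom_of_dvd` — for `p ∣ ℓ − 1` a hom `π₀` with `π₀ u = 1 ↔ u^{(ℓ−1)/p} = 1` and `π₀ ≠ 1`
  (`u ↦ u^{(ℓ−1)/p} ∈ μ_p(𝔽_ℓ) ≅ ℤ/p`, Mathlib `HasEnoughRootsOfUnity (ZMod ℓ) (ℓ-1)`, `mulEquivOfPrimeCardEq`).
* §2 (over `ℚ`) `exists_apply_ne_one` — `χ ≠ 1` as soon as `π₀ ≠ 1` (the cyclotomic character maps the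
  inertia group at `ℓ` ONTO `ℤ_ℓˣ`, tree `exists_mem_inertia_cyclotomicCharacter_eq`; unit lifting in `ℤ_ℓ`);
  the ONE-KUMMER-PRIME certificate consuming these (`X2.algebraicLambdaGE_of_kummerPrime`: `λ ≥ #S` at the
  étale end from one Kummer prime `ℓ` and residue checks `q^{(ℓ−1)/p} ≡ 1 (mod ℓ)`) is the sequel file
  `…KummerPrimeCertificate`.

References: [SerreAbelianLadic1968] I §1.2; [NeukirchANT1999] II §9 (9.6); [NeukirchSchmidtWingberg2008]
Thm. 7.5.3; [GreenbergLNM1716] §5 proof of Prop. 5.10; [Washington1997] §13.1.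
-/

set_option autoImplicit false
-- `Summit.BirchSwinnertonDyer.BirchSwinnertonDyer.…`: the summit and its single sub-problem share a name (D-0017 layout).
set_option linter.dupNamespace false

noncomputable section

open scoped Classical Pointwise

open Function Field NumberField IsDedekindDomain
  Literature.NumberTheory.EllipticCurves Literature.NumberTheory.GaloisRepresentations

namespace Summit.BirchSwinnertonDyer.BirchSwinnertonDyer.Theorems.EisensteinPrimesMazurMCOnCellBKummerCharacterSupply

section Supply

variable (K : Type) [Field K] [NumberField K] (ℓ : ℕ) [hℓ : Fact ℓ.Prime] {p : ℕ} [hp : Fact p.Prime]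
  (π₀ : (ZMod ℓ)ˣ →* Multiplicative (ZMod p))

omit [NumberField K] in
/-- **The character `χ = π₀ ∘ (χ_cyc,ℓ mod ℓ)` of `Γ_K`.** For any field `K` of characteristic `0`... (here a
number field), a prime `ℓ` and a hom `π₀ : (ℤ/ℓ)ˣ →* Multiplicative (ZMod p)`: there are a reduction
`red : ℤ_ℓ →+* ℤ/ℓ` with `red n = n` (`ZMod.castHom ∘ PadicInt.toZModPow 1`, continuous) and a CONTINUOUS
character `χ : Γ_K →ₜ* ℤ/p` with `χ σ = π₀ (red (χ_cyc,ℓ σ))` (`GaloisRep.cyclotomicCharacter K ℓ`).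
Existence with the formula; no definition introduced. [cite: SerreAbelianLadic1968, Ch. I §1.2] -/
theorem exists_character_of_cyclotomicCharacter :
    ∃ (red : ℤ_[ℓ] →+* ZMod ℓ) (χ : absoluteGaloisGroup K →ₜ* Multiplicative (ZMod p)),
      (∀ n : ℕ, red n = n) ∧
      ∀ σ, χ σ = π₀ (Units.map (red : ℤ_[ℓ] →* ZMod ℓ) (GaloisRep.cyclotomicCharacter K ℓ σ)) := by
  let red : ℤ_[ℓ] →+* ZMod ℓ :=
    (ZMod.castHom (dvd_pow_self ℓ one_ne_zero) (ZMod ℓ)).comp (PadicInt.toZModPow 1)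
  have hred_cont : Continuous red :=
    (continuous_of_discreteTopology (f := (ZMod.castHom (dvd_pow_self ℓ one_ne_zero) (ZMod ℓ))))
      |>.comp (PadicInt.continuous_toZModPow ℓ 1)
  have hu_cont : Continuous (Units.map (red : ℤ_[ℓ] →* ZMod ℓ)) := Continuous.units_map _ hred_cont
  let χ : absoluteGaloisGroup K →ₜ* Multiplicative (ZMod p) :=
    { toFun := fun σ ↦ π₀ (Units.map (red : ℤ_[ℓ] →* ZMod ℓ) (GaloisRep.cyclotomicCharacter K ℓ σ))
      map_one' := by rw [map_one, map_one, map_one]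
      map_mul' := fun a b ↦ by rw [map_mul, map_mul, map_mul]
      continuous_toFun := (continuous_of_discreteTopology (f := π₀)).comp
        (hu_cont.comp (GaloisRep.cyclotomicCharacter K ℓ).continuous) }
  exact ⟨red, χ, fun n ↦ map_natCast red n, fun σ ↦ rfl⟩

variable {K ℓ}

/-- **`χ` is unramified at every `v ∤ ℓ`**: `χ(res τ) = 1` for `τ` in the inertia group `absInertia K_v`
(`res τ ∈ I_{𝔓₀}`, Neukirch II (9.6), tree `inertia_adicCompletionPrime_eq_map_absInertia`, and the
`ℓ`-adic cyclotomic character kills `I_{𝔓₀}` for `v ∤ ℓ`, Serre I-1.2, tree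
`smul_eq_self_of_mem_inertia_of_pow_prime_pow_eq_one`). [cite: SerreAbelianLadic1968, Ch. I §1.2]
[cite: NeukirchANT1999, Ch. II §9 Prop. (9.6)] -/
theorem character_eq_one_of_mem_absInertia (red : ℤ_[ℓ] →+* ZMod ℓ)
    (χ : absoluteGaloisGroup K →ₜ* Multiplicative (ZMod p))
    (hχ : ∀ σ, χ σ = π₀ (Units.map (red : ℤ_[ℓ] →* ZMod ℓ) (GaloisRep.cyclotomicCharacter K ℓ σ)))
    {v : HeightOneSpectrum (𝓞 K)} (hℓv : ((ℓ : ℕ) : 𝓞 K) ∉ v.asIdeal)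
    {τ : absoluteGaloisGroup (v.adicCompletion K)} (hτ : τ ∈ absInertia (v.adicCompletion K)) :
    χ (resGal (K := K) (v.adicCompletion K) τ) = 1 := by
  have hx : absGaloisRestrict K (v.adicCompletion K) τ ∈
      (adicCompletionPrime K v).inertia (absoluteGaloisGroup K) := by
    rw [inertia_adicCompletionPrime_eq_map_absInertia]
    exact Subgroup.mem_map.mpr ⟨τ, hτ, rfl⟩
  have h1 : GaloisRep.cyclotomicCharacter K ℓ (absGaloisRestrict K (v.adicCompletion K) τ) = 1 := by
    rw [GaloisRep.cyclotomicCharacter_apply]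
    exact cyclotomicCharacter_eq_one_of_forall_pow_eq_one ℓ _ fun _ _ ht ↦
      smul_eq_self_of_mem_inertia_of_pow_prime_pow_eq_one hℓv
        (adicCompletionPrime_mem_primesAbove K v) hx ht
  change χ (absGaloisRestrict K (v.adicCompletion K) τ) = 1
  rw [hχ, h1, map_one, map_one]

/-- **`χ` is trivial on `Γ_{K_v}` when `π₀` kills `N v (mod ℓ)`** (`v ∤ ℓ`): for every unit `u` of
`ℤ/ℓ` with `u = N v`, `π₀ u = 1` ⟹ `χ(res σ) = 1` for ALL `σ ∈ Γ_{K_v}`. A Frobenius `φ` of `K_v`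
(`exists_isAbsArithFrob_holds`) restricts to an arithmetic Frobenius at `𝔓₀`
(`isArithFrobAt_absGaloisRestrict_adicCompletionPrime_iff`), so `χ_cyc,ℓ(res φ) = N v`
(`GaloisRep.cyclotomicCharacter_apply_of_isArithFrobAt`) and `χ(res φ) = π₀(N v) = 1`; `χ ∘ res` kills the
inertia group (previous lemma), hence the dense subset `I_v·⟨φ⟩` (`dense_absInertia_mul_zpowers_of_isFrobPow`),
hence — its kernel being closed — all of `Γ_{K_v}`. [cite: SerreAbelianLadic1968, Ch. I §1.2]
[cite: NeukirchSchmidtWingberg2008, Thm. 7.5.3] [cite: NeukirchANT1999, Ch. II §9 Prop. (9.6)] -/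
theorem character_eq_one_of_residueCard (red : ℤ_[ℓ] →+* ZMod ℓ) (hred : ∀ n : ℕ, red n = n)
    (χ : absoluteGaloisGroup K →ₜ* Multiplicative (ZMod p))
    (hχ : ∀ σ, χ σ = π₀ (Units.map (red : ℤ_[ℓ] →* ZMod ℓ) (GaloisRep.cyclotomicCharacter K ℓ σ)))
    {v : HeightOneSpectrum (𝓞 K)} (hℓv : ((ℓ : ℕ) : 𝓞 K) ∉ v.asIdeal)
    (hπ : ∀ u : (ZMod ℓ)ˣ, (u : ZMod ℓ) = (v.residueCard : ZMod ℓ) → π₀ u = 1)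
    (σ : absoluteGaloisGroup (v.adicCompletion K)) :
    χ (resGal (K := K) (v.adicCompletion K) σ) = 1 := by
  set Kv := v.adicCompletion K with hKv
  -- a Frobenius of `K_v`; its image is an arithmetic Frobenius at `𝔓₀`, so `χ_ℓ(res φ) = N v`
  obtain ⟨φ, hφ⟩ := exists_isAbsArithFrob_holds Kv
  have hφ1 : IsFrobPow φ 1 := IsAbsArithFrob.isFrobPow_holds hφ
  have hglob : IsArithFrobAt (𝓞 K) (absGaloisRestrict K Kv φ) (adicCompletionPrime K v) :=
    (isArithFrobAt_absGaloisRestrict_adicCompletionPrime_iff (K := K) (v := v)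
      (by rw [Literature.NumberTheory.Automorphic.residueFieldCard_adicCompletion_eq,
        v.residueCard_eq_card_quotient]) φ).mpr hφ
  have hval : ((GaloisRep.cyclotomicCharacter K ℓ (absGaloisRestrict K Kv φ) : ℤ_[ℓ]ˣ) : ℤ_[ℓ]) =
      (v.residueCard : ℤ_[ℓ]) :=
    GaloisRep.cyclotomicCharacter_apply_of_isArithFrobAt hℓv (adicCompletionPrime_mem_primesAbove K v) hglob
  -- the continuous character `ψ = χ ∘ res` kills the inertia group and `φ`
  let ψ : absoluteGaloisGroup Kv →ₜ* Multiplicative (ZMod p) := χ.comp (resGal (K := K) Kv)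
  have hψI : ∀ τ ∈ absInertia Kv, ψ τ = 1 := fun τ hτ ↦
    character_eq_one_of_mem_absInertia π₀ red χ hχ hℓv hτ
  have hψφ : ψ φ = 1 := by
    change χ (absGaloisRestrict K Kv φ) = 1
    rw [hχ]
    apply hπ
    rw [Units.coe_map, MonoidHom.coe_coe, hval, hred]
  -- its kernel is closed and contains the dense set `I · ⟨φ⟩`
  have hker : (absInertia Kv : Set (absoluteGaloisGroup Kv)) * (Subgroup.zpowers φ : Set _) ⊆
      (ψ.toMonoidHom.ker : Set (absoluteGaloisGroup Kv)) := by
    rintro _ ⟨a, ha, b, hb, rfl⟩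
    obtain ⟨k, rfl⟩ := Subgroup.mem_zpowers_iff.mp hb
    change ψ (a * φ ^ k) = 1
    rw [map_mul, map_zpow, hψI a ha, hψφ, one_zpow, one_mul]
  have hclosed : IsClosed (ψ.toMonoidHom.ker : Set (absoluteGaloisGroup Kv)) :=
    (isClosed_discrete ({1} : Set (Multiplicative (ZMod p)))).preimage ψ.continuous
  have hdense : Dense (ψ.toMonoidHom.ker : Set (absoluteGaloisGroup Kv)) :=
    (dense_absInertia_mul_zpowers_of_isFrobPow Kv hφ1).mono hker
  have hall : (ψ.toMonoidHom.ker : Set (absoluteGaloisGroup Kv)) = Set.univ := by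
    rw [← hclosed.closure_eq, hdense.closure_eq]
  have hσ : σ ∈ (ψ.toMonoidHom.ker : Set (absoluteGaloisGroup Kv)) := by rw [hall]; exact Set.mem_univ σ
  exact hσ

omit [NumberField K] in
/-- **For `p ∣ ℓ − 1` there is a hom `π₀ : (ℤ/ℓ)ˣ →* ℤ/p` with kernel the `p`-th powers**:
`π₀ u = 1 ↔ u^{(ℓ−1)/p} = 1`, and `π₀ ≠ 1` (a generator `g` of the cyclic group `(ℤ/ℓ)ˣ` has
`g^{(ℓ−1)/p} ≠ 1`). Construction: `u ↦ u^{(ℓ−1)/p} ∈ μ_p(𝔽_ℓ)`, a group of order `p`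
(`HasEnoughRootsOfUnity (ZMod ℓ) (ℓ-1)` and `.of_dvd`), identified with `Multiplicative (ZMod p)` by
`mulEquivOfPrimeCardEq`. [folklore] -/
theorem exists_unitsHom_of_dvd (hpl : p ∣ ℓ - 1) :
    ∃ π₀ : (ZMod ℓ)ˣ →* Multiplicative (ZMod p),
      (∀ u : (ZMod ℓ)ˣ, π₀ u = 1 ↔ u ^ ((ℓ - 1) / p) = 1) ∧ ∃ u : (ZMod ℓ)ˣ, π₀ u ≠ 1 := by
  have hℓ1 : 0 < ℓ - 1 := by have := hℓ.out.two_le; omega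
  haveI : NeZero (ℓ - 1) := ⟨hℓ1.ne'⟩
  haveI : NeZero p := ⟨hp.out.ne_zero⟩
  haveI hen : HasEnoughRootsOfUnity (ZMod ℓ) p := HasEnoughRootsOfUnity.of_dvd (ZMod ℓ) hpl
  have hcardR : Nat.card (rootsOfUnity p (ZMod ℓ)) = p :=
    HasEnoughRootsOfUnity.natCard_rootsOfUnity (ZMod ℓ) p
  have hcardZ : Nat.card (Multiplicative (ZMod p)) = p := by
    rw [Nat.card_congr Multiplicative.toAdd, Nat.card_zmod]
  let e : rootsOfUnity p (ZMod ℓ) ≃* Multiplicative (ZMod p) := mulEquivOfPrimeCardEq hcardR hcardZ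
  set d : ℕ := (ℓ - 1) / p with hddef
  have hd : d * p = ℓ - 1 := Nat.div_mul_cancel hpl
  let ρ : (ZMod ℓ)ˣ →* rootsOfUnity p (ZMod ℓ) :=
    { toFun := fun u ↦ ⟨u ^ d, by
        rw [mem_rootsOfUnity, ← pow_mul, hd]
        exact ZMod.units_pow_card_sub_one_eq_one ℓ u⟩
      map_one' := Subtype.ext (one_pow d)
      map_mul' := fun a b ↦ Subtype.ext (mul_pow a b d) }
  have hρ : ∀ u : (ZMod ℓ)ˣ, ((ρ u : rootsOfUnity p (ZMod ℓ)) : (ZMod ℓ)ˣ) = u ^ d := fun u ↦ rfl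
  refine ⟨e.toMonoidHom.comp ρ, fun u ↦ ?_, ?_⟩
  · rw [MonoidHom.comp_apply, MulEquiv.coe_toMonoidHom, MulEquiv.map_eq_one_iff, ← hρ u,
      OneMemClass.coe_eq_one]
  · -- a generator `g` of the cyclic group `(ℤ/ℓ)ˣ` has `g^d ≠ 1` (`0 < d < ℓ - 1 = ord g`)
    obtain ⟨g, hg⟩ := IsCyclic.exists_generator (α := (ZMod ℓ)ˣ)
    have hord : orderOf g = ℓ - 1 := by
      rw [orderOf_eq_card_of_forall_mem_zpowers hg, Nat.card_eq_fintype_card, ZMod.card_units]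
    have hdpos : 0 < d := Nat.div_pos (Nat.le_of_dvd hℓ1 hpl) hp.out.pos
    have hdlt : d < ℓ - 1 := by
      rw [hddef]
      exact Nat.div_lt_self hℓ1 hp.out.one_lt
    refine ⟨g, fun h ↦ ?_⟩
    rw [MonoidHom.comp_apply, MulEquiv.coe_toMonoidHom, MulEquiv.map_eq_one_iff, ← OneMemClass.coe_eq_one,
      hρ] at h
    exact pow_ne_one_of_lt_orderOf hdpos.ne' (hord ▸ hdlt) h

end Supply

/-! ## §2. Over `ℚ`: non-triviality, and the one-Kummer-prime certificate -/

section Rat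

variable {ℓ : ℕ} [hℓ : Fact ℓ.Prime] {p : ℕ} [hp : Fact p.Prime]
  (π₀ : (ZMod ℓ)ˣ →* Multiplicative (ZMod p))

/-- **Over `ℚ`, `χ ≠ 1` as soon as `π₀ ≠ 1`**: a unit `u₀` of `ℤ/ℓ` with `π₀ u₀ ≠ 1` lifts to a unit
`t ∈ ℤ_ℓˣ` (its representative `n`, `ℓ ∤ n`, has `‖n‖_ℓ = 1`), and the `ℓ`-adic cyclotomic character maps
the inertia group at `ℓ` ONTO `ℤ_ℓˣ` (tree `exists_mem_inertia_cyclotomicCharacter_eq`), so some `τ` has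
`χ τ = π₀ u₀ ≠ 1`. [cite: SerreLocalFields1979, Ch. IV §4 Prop. 17] [cite: Washington1997, §13.1] -/
theorem exists_apply_ne_one (red : ℤ_[ℓ] →+* ZMod ℓ) (hred : ∀ n : ℕ, red n = n)
    (χ : absoluteGaloisGroup ℚ →ₜ* Multiplicative (ZMod p))
    (hχ : ∀ σ, χ σ = π₀ (Units.map (red : ℤ_[ℓ] →* ZMod ℓ) (GaloisRep.cyclotomicCharacter ℚ ℓ σ)))
    (hπ₀ : ∃ u : (ZMod ℓ)ˣ, π₀ u ≠ 1) : ∃ σ : absoluteGaloisGroup ℚ, χ σ ≠ 1 := by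
  obtain ⟨u₀, hu₀⟩ := hπ₀
  -- lift `u₀` to a unit of `ℤ_ℓ`
  set n : ℕ := (u₀ : ZMod ℓ).val with hn
  have hn0 : ¬ ℓ ∣ n := fun h ↦ by
    have h1 : ((n : ℕ) : ZMod ℓ) = 0 := (ZMod.natCast_eq_zero_iff n ℓ).mpr h
    rw [hn, ZMod.natCast_zmod_val] at h1
    exact u₀.ne_zero h1
  have hunit : IsUnit ((n : ℤ) : ℤ_[ℓ]) := by
    rw [PadicInt.isUnit_iff]
    refine le_antisymm (PadicInt.norm_le_one _) (not_lt.mp fun h ↦ hn0 ?_)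
    exact Int.natCast_dvd_natCast.mp ((PadicInt.norm_int_lt_one_iff_dvd (p := ℓ) (n : ℤ)).mp h)
  set t : ℤ_[ℓ]ˣ := hunit.unit with ht
  have hut : Units.map (red : ℤ_[ℓ] →* ZMod ℓ) t = u₀ := by
    ext
    rw [Units.coe_map, MonoidHom.coe_coe, ht, IsUnit.unit_spec, Int.cast_natCast, hred, hn,
      ZMod.natCast_zmod_val]
  -- the cyclotomic character maps the inertia group at `ℓ` onto `ℤ_ℓˣ`
  set vℓ : HeightOneSpectrum (𝓞 ℚ) := (Rat.HeightOneSpectrum.primesEquiv (R := 𝓞 ℚ)).symm ⟨ℓ, hℓ.out⟩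
    with hvℓdef
  have hvℓ : (Rat.HeightOneSpectrum.primesEquiv vℓ : ℕ) = ℓ :=
    congrArg Subtype.val ((Rat.HeightOneSpectrum.primesEquiv (R := 𝓞 ℚ)).apply_symm_apply ⟨ℓ, hℓ.out⟩)
  obtain ⟨τ, -, hτ⟩ := Literature.NumberTheory.EllipticCurves.exists_mem_inertia_cyclotomicCharacter_eq
    ℓ hvℓ (adicCompletionPrime_mem_primesAbove ℚ vℓ) t
  refine ⟨τ, fun h ↦ hu₀ ?_⟩
  rw [hχ, hτ, hut] at h
  exact h

end Rat


end Summit.BirchSwinnertonDyer.BirchSwinnertonDyer.Theorems.EisensteinPrimesMazurMCOnCellBKummerCharacterSupply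

end
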